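import Literature.AlgebraicGeometry.Resolution.KedlayaEtaleCovers
import Literature.AlgebraicGeometry.Resolution.KedlayaEtaleCoversAlgebra
import Literature.AlgebraicGeometry.Resolution.KedlayaEtaleCoversForms
import Literature.AlgebraicGeometry.Resolution.KedlayaEtaleCoversChart
import Literature.AlgebraicGeometry.Resolution.AlterationsDimension
import Literature.AlgebraicGeometry.Motives.AbelianVarietyDegree
import Literature.AlgebraicGeometry.Motives.CartierDivisorAmple
import Literature.AlgebraicGeometry.Motives.CartierDivisorClassPullback
import Literature.AlgebraicGeometry.Motives.VarietiesDimensionProofs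
import HarnessLib

/-!
# Kedlaya's étale covers of affine space: proof of the named fact

Topic `Literature/AlgebraicGeometry/Resolution`. Discharge of
`Literature.AlgebraicGeometry.Resolution.Kedlaya2004_finite_etale_off_hyperplane`
(`KedlayaEtaleCovers.lean`): K. S. Kedlaya, *More étale covers of affine spaces in positive
characteristic*, J. Algebraic Geom. 14 (2005) 187–192, **Theorem 1**, in the specialised form vendored
there (an integral `X` finite over `ℙᴺ_k`, `k` perfect of characteristic `p`, admits a finite
surjective `k`-morphism `f : X → ℙⁿ_k` étale over the chart `D₊(xₙ)`).

## The printed proof and this formalisation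

Kedlaya's proof (loc. cit., §3, proof of Thm. 1): choose sections `s₁, …, sₙ` of (a power of) the
ample `𝓛` inducing an unramified map `U → 𝔸ⁿ` on a dense open `U` (Lemma 6: regular functions
`aᵢ` with `daᵢ` a basis of `Ω`, multiplied by a section `s` non-vanishing on `U`); a section `t`
"which vanishes on `E = X ∖ U`" (Lemma 4); sections `t₁, …, tₙ` "which have no common zero on the
vanishing locus `Z` of `t`" (Lemma 5); and then
`u₀ = t^{pl}`, `uᵢ = sᵢ s^{m(pr-1)} t^{p(l-1)} + tᵢ^p` "have no common zero, so they induce a finite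
map `f : X → ℙⁿ`"; on `{u₀ ≠ 0} = U ∩ {t ≠ 0}`, "`d(uᵢ/u₀) = … daᵢ`" since `d(cᵖ) = 0`, so `f` is
unramified, hence étale, over the complement of the hyperplane `u₀ = 0`.

We follow this architecture in the tree's language of Cartier divisors and generating sections
(`Motives/CartierDivisor*`, `Motives/MorphismsToProjectiveSpace`, `Motives/FormsOnSections`); the
sections of this file are the steps, assembled in `Kedlaya2004.exists_finite_etale_off_hyperplane`:
* §1 `exists_base_family`: the divisor `D` of a hyperplane section of `g : X → ℙᴺ` with its
  generating sections `s₀, …, s_{N₀}` (affine non-vanishing loci covering `X`) and the affine chart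
  `V₀ ∋ η` on which `D` is trivial; then (Lemma 6, `Kedlaya2004.exists_etale_coordinates`) étale
  coordinates `a₁, …, aₙ` on an affine `V ∋ η`, `V ⊆ V₀`;
* §2 `exists_form_t`: the form `t` (Lemma 4 with `S = {η}`, via homogeneous vanishing
  `Kedlaya2004.exists_form_mem_of_notMem` for the finite `ψ₀ = (s₀ : … : s_{N₀}) : X → ℙ^{N₀}`):
  `X_t` affine, `η ∈ X_t ⊆ V`, so `X_t = X_{t₀}` is a basic open of `V`;
* §3 `exists_pow_mul_isSection`: `bᵢ := t^{r+1} aᵢ` are sections of `𝒪(e D)`, `e = (r+1)A`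
  (extension through `t`, `CartierDivisor.exists_forall_le_isSection_pow_mul`); `t' := t^{r+1}`;
* §4 `topologicalKrullDim_eq_of_etale_coordinates`: `dim X = n` (`X_t → Spec k` is smooth of
  relative dimension `n`), so `dim (X ∖ X_t) < n`;
* §5 the family `Σ = (s_l^e)_l, t', (bᵢ)ᵢ` of sections of `e D` (affine loci, no common zero;
  `exists_fin_family`), the forms `T₁, …, Tₙ` of degree `δ = 2^c` in `Σ` with no common zero on
  `X ∖ X_t` (Lemma 5, `Kedlaya2004.exists_forms_baseLocus_inter_eq_empty`), and Kedlaya's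
  `Uₙ := Y_{t'}^{m+1}`, `Uⱼ := Y_{bⱼ} Y_{t'}^m + Tⱼ^p` (`m + 1 = pδ`; `U_mem_grading`,
  `exists_mem_nonvanishing_U`): forms in `Σ` without common zero, so
  `ψ := (u₀ : … : uₙ) : X → ℙⁿ` is affine, hence finite (`X` proper);
* §6 over `D₊(yₙ)`: `ψ⁻¹ D₊(yₙ) = X_{uₙ} = X_t`, `uⱼ/uₙ = aⱼ + cⱼ^p` with `cⱼ = Tⱼ(Σ)/t'^δ`,
  `d(aⱼ + cⱼ^p) = daⱼ` a basis of `Ω_{Γ(X_t)/k}` ⇒ the chart ring map is étale (Jacobi–Zariski,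
  `Kedlaya2004.ringHom_etale_of_basis`; `etale_eval₂Hom_of_coordinates`, `etale_toProj_chart`) ⇒
  `Etale (ψ ∣_ D₊(yₙ))` (`Kedlaya2004.etale_morphismRestrict_toProj`);
* §7 assembly; surjectivity from finiteness and `dim X = n` (`surjective_of_isFinite_of_dim`).
Deviations from the printed proof: `S = ∅`; the hyperplane at infinity is `yₙ = 0` rather than
`u₀ = 0`; prime avoidance (Lemmas 3–5) is replaced by the tree's
`CartierDivisor.exists_forall_le_form_generic`; "sections of `𝓛^{⊗j}`" are forms of degree `j` in a
fixed finite family of sections with affine non-vanishing loci (so that all loci `X_u` are affine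
by `CartierDivisor.isAffineOpen_nonvanishingOpens_aeval`, avoiding Serre vanishing).

## References

* K. S. Kedlaya, *More étale covers of affine spaces in positive characteristic*, J. Algebraic
  Geom. 14 (2005) 187–192 (arXiv:math/0303382), Thm. 1, Lemmas 4–6 and proof of Thm. 1. [Kedlaya2004]
* R. Hartshorne, *Algebraic Geometry* (1977), II Thm. 7.1. [Hartshorne1977]
* U. Görtz, T. Wedhorn, *Algebraic Geometry I* (2nd ed., 2020), (11.9), (13.11), Prop. 13.47. [GortzWedhorn2020]
-/

noncomputable section

universe u

open CategoryTheory AlgebraicGeometry TopologicalSpace Opposite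
open MvPolynomial (aeval)
open Literature.AlgebraicGeometry.Motives Literature.AlgebraicGeometry.Motives.RatFn
open Literature.AlgebraicGeometry.Motives.Segre Literature.Topology

attribute [local instance] MvPolynomial.gradedAlgebra

namespace Literature.AlgebraicGeometry.Resolution

namespace Kedlaya2004

/-! ### §1 The divisor of a hyperplane section and its generating sections -/

section BaseFamily

variable {X : Scheme.{u}} [IsIntegral X] {N : ℕ} (G : GeneratingSections (Fin (N + 1)) X)

/-- **The base family.** From generating sections `G` with affine charts (e.g. those of an affine
morphism `g : X → ℙᴺ`): the Cartier divisor `D = div s_{j₀}` of a section non-vanishing at the generic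
point, its global sections `s_l / s_{j₀}` indexed by `Fin (N₀ + 1)` (the charts meeting `X`, i.e.
containing `η`) — sections of `𝒪(D)` with affine non-vanishing loci `X_{s_l} = U_l` covering `X` —
and the affine chart `V₀ = U_{j₀} ∋ η` on which the local equation of `D` is `1`, so that sections of
`𝒪(e D)` are regular functions on `V₀` and `X_σ ∩ V₀ = {σ ∈ 𝒪^×}` (Görtz–Wedhorn I, (11.9), (13.12);
Hartshorne II Thm. 7.1). [folklore] -/
theorem exists_base_family (hGaff : ∀ l, IsAffineOpen (G.U l)) :
    ∃ (D : CartierDivisor X) (N₀ : ℕ) (s : Fin (N₀ + 1) → X.functionField) (V₀ : X.Opens),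
      (∀ i, D.IsSection (s i)) ∧ (∀ i, genericPoint X ∈ D.nonvanishingOpens (s i)) ∧
      (∀ x : X, ∃ i, x ∈ D.nonvanishing (s i)) ∧
      (∀ i, IsAffineOpen (D.nonvanishingOpens (s i))) ∧
      IsAffineOpen V₀ ∧ genericPoint X ∈ V₀ ∧
      ∀ (e : ℕ) (σ : X.functionField), (e • D).IsSection σ → ∀ x ∈ V₀,
        IsRegularAt x σ ∧ (x ∈ (e • D).nonvanishing σ ↔ IsUnitAt x σ) := by
  classical
  obtain ⟨j₀, hj₀⟩ := G.exists_mem_U (genericPoint X)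
  have hcard : 0 < Fintype.card {l : Fin (N + 1) // genericPoint X ∈ G.U l} :=
    Fintype.card_pos_iff.mpr ⟨⟨j₀, hj₀⟩⟩
  obtain ⟨N₀, hN₀⟩ : ∃ N₀, Fintype.card {l : Fin (N + 1) // genericPoint X ∈ G.U l} = N₀ + 1 :=
    ⟨Fintype.card {l : Fin (N + 1) // genericPoint X ∈ G.U l} - 1, by omega⟩
  set eqv : Fin (N₀ + 1) ≃ {l : Fin (N + 1) // genericPoint X ∈ G.U l} :=
    (Fintype.equivFinOfCardEq hN₀).symm with heqv
  refine ⟨G.divisor j₀ hj₀, N₀, fun i => G.ratioFn j₀ (eqv i).1 hj₀, G.U j₀,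
    fun i => G.isSection_divisor_ratioFn j₀ hj₀ _, fun i => ?_, fun x => ?_, fun i => ?_,
    hGaff j₀, hj₀, fun e σ hσ x hx => ?_⟩
  · change genericPoint X ∈ (G.divisor j₀ hj₀).nonvanishing _
    rw [G.nonvanishing_divisor_ratioFn]
    exact (eqv i).2
  · obtain ⟨l, hl⟩ := G.exists_mem_U x
    refine ⟨eqv.symm ⟨l, G.genericPoint_mem_U hl⟩, ?_⟩
    rw [G.nonvanishing_divisor_ratioFn, Equiv.apply_symm_apply]
    exact hl
  · have h : (G.divisor j₀ hj₀).nonvanishingOpens (G.ratioFn j₀ (eqv i).1 hj₀) = G.U (eqv i).1 :=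
      Opens.ext (G.nonvanishing_divisor_ratioFn j₀ hj₀ _)
    rw [h]
    exact hGaff _
  · have hxU : x ∈ (e • G.divisor j₀ hj₀).U (ULift.up ⟨j₀, hj₀⟩) := hx
    have hf : (e • G.divisor j₀ hj₀).f (ULift.up ⟨j₀, hj₀⟩) = 1 := by
      rw [CartierDivisor.smul_f]
      change G.ratioFn j₀ j₀ hj₀ ^ e = 1
      rw [G.ratioFn_self, one_pow]
    have h1 := hσ (ULift.up ⟨j₀, hj₀⟩) x hxU
    rw [hf, one_mul] at h1
    refine ⟨h1, ?_⟩
    rw [CartierDivisor.mem_nonvanishing_iff hxU, hf, one_mul]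

/-- The generic point lies in `X_σ` iff the section `σ` of `𝒪(D)` is a nonzero rational function.
[folklore] -/
theorem genericPoint_mem_nonvanishing_iff (D : CartierDivisor X)
    (σ : X.functionField) : genericPoint X ∈ D.nonvanishing σ ↔ σ ≠ 0 := by
  refine ⟨CartierDivisor.ne_zero_of_mem_nonvanishing, fun h => ?_⟩
  obtain ⟨c, hc⟩ := D.covers (genericPoint X)
  exact ⟨c, hc, isUnitAt_genericPoint (mul_ne_zero (D.f_ne_zero c) h)⟩

end BaseFamily

/-! ### §2 The form `t`: an affine neighbourhood `X_t ∋ η` inside a given open -/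

section FormT

variable {k : Type u} [Field k] {X : Scheme.{u}} [IsIntegral X] [X.Over (Spec (.of k))]
  {D : CartierDivisor X} {N₀ : ℕ} {s : Fin (N₀ + 1) → X.functionField}
  (hs : ∀ i, D.IsSection (s i)) (hξ : ∀ i, genericPoint X ∈ D.nonvanishingOpens (s i))
  (hcov : ∀ x : X, ∃ i, x ∈ D.nonvanishing (s i))
  (haff : ∀ i, IsAffineOpen (D.nonvanishingOpens (s i)))

include hs hξ hcov haff in
/-- **Kedlaya's section `t` (Lemma 4 with `S = {η}`): a form `t = F(s)` of positive degree `A` in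
the generating sections, non-vanishing at the generic point, whose (affine) non-vanishing locus
`X_t` lies inside the given open `V ∋ η`.** Proof: `ψ₀ = (s₀ : … : s_{N₀}) : X → ℙ^{N₀}` is
finite (`X` proper), so `ψ₀(X ∖ V)` is closed and — the fibres of `ψ₀` being discrete — misses
`ψ₀(η)`; take a form `F` vanishing on it but not at `ψ₀(η)` (`exists_form_mem_of_notMem`), times
`x₀`. [cite: Kedlaya2004, Lemma 4] -/
theorem exists_form_t [IsProper (X ↘ Spec (.of k))] (V : X.Opens) (hηV : genericPoint X ∈ V) :
    ∃ (A : ℕ) (t : X.functionField), 0 < A ∧ (A • D).IsSection t ∧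
      genericPoint X ∈ (A • D).nonvanishing t ∧
      IsAffineOpen ((A • D).nonvanishingOpens t) ∧
      ∀ x, x ∈ (A • D).nonvanishing t → x ∈ V := by
  classical
  set ψ₀ := (D.toGeneratingSections s hs hξ hcov).toProj (X ↘ Spec (.of k)) with hψ₀
  haveI : IsAffineHom ψ₀ := GeneratingSections.isAffineHom_toProj _ _ haff
  haveI : IsFinite ψ₀ :=
    isFinite_of_isAffineHom_of_comp_eq ψ₀ (GeneratingSections.toProj_toSpec _ _)
  -- the closed set `ψ₀ (X ∖ V)` misses `q := ψ₀ η`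
  set Z : Set (ProjSpace.P N₀ k) := ψ₀.base '' ((V : Set X)ᶜ) with hZ
  have hZc : IsClosed Z := ψ₀.isClosedMap _ V.isOpen.isClosed_compl
  have hqZ : ψ₀.base (genericPoint X) ∉ Z := by
    rintro ⟨x, hxV, hx⟩
    apply hxV
    have hS := ψ₀.isDiscrete_preimage_singleton (ψ₀.base (genericPoint X))
    rw [isDiscrete_iff_discreteTopology] at hS
    have h : (⟨genericPoint X, rfl⟩ : ψ₀.base ⁻¹' {ψ₀.base (genericPoint X)}) ⤳ ⟨x, hx⟩ := by
      rw [subtype_specializes_iff]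
      exact (genericPoint_spec X).specializes (Set.mem_univ _)
    have hxe : genericPoint X = x := congrArg Subtype.val h.eq
    rw [← hxe]; exact hηV
  obtain ⟨e₁, F₁, hF₁, hF₁q, hF₁Z⟩ :=
    exists_form_mem_of_notMem (grading (Fin (N₀ + 1)) k) Z hZc _ hqZ
  -- multiply by `x₀` to get positive degree
  have hX0q : (MvPolynomial.X 0 : MvPolynomial (Fin (N₀ + 1)) k) ∉
      (ψ₀.base (genericPoint X)).asHomogeneousIdeal := by
    refine (D.mem_nonvanishing_aeval_iff hs hξ hcov one_pos (X_mem k 0) (genericPoint X)).mp ?_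
    rw [MvPolynomial.aeval_X, D.one_smul]
    exact hξ 0
  have hF₂ : F₁ * MvPolynomial.X 0 ∈ grading (Fin (N₀ + 1)) k (e₁ + 1) :=
    SetLike.mul_mem_graded hF₁ (X_mem k 0)
  have hprime := (ψ₀.base (genericPoint X)).isPrime
  refine ⟨e₁ + 1, aeval s (F₁ * MvPolynomial.X 0), Nat.succ_pos _, D.isSection_aeval hs hF₂, ?_,
    D.isAffineOpen_nonvanishingOpens_aeval hs hξ hcov haff (Nat.succ_pos _) hF₂, fun x hx => ?_⟩
  · rw [D.mem_nonvanishing_aeval_iff hs hξ hcov (Nat.succ_pos _) hF₂]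
    exact fun h => (hprime.mem_or_mem h).elim hF₁q hX0q
  · by_contra hxV
    have hxZ : ψ₀.base x ∈ Z := ⟨x, hxV, rfl⟩
    rw [D.mem_nonvanishing_aeval_iff hs hξ hcov (Nat.succ_pos _) hF₂] at hx
    exact hx (Ideal.mul_mem_right _ _ (hF₁Z _ hxZ))

end FormT

/-! ### §3 Extension of regular functions on `X_t` through powers of `t` -/

section Extension

variable {X : Scheme.{u}} [IsIntegral X]

/-- **`t^r αᵢ` and `t^{r+1} αᵢ` are global sections** for finitely many rational functions `αᵢ`
regular on `X_t` and `r ≫ 0` (Görtz–Wedhorn I, Thm. 7.22: sections over `X_t` extend after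
multiplication by a power of `t`; `CartierDivisor.exists_forall_le_isSection_pow_mul`).
[cite: GortzWedhorn2020, Thm. 7.22 (2) (p. 230)] -/
theorem exists_pow_mul_isSection [CompactSpace X] {D : CartierDivisor X} {A : ℕ}
    {t : X.functionField} (ht : (A • D).IsSection t) {n : ℕ} (α : Fin n → X.functionField)
    (hα : ∀ i, ∀ x ∈ (A • D).nonvanishing t, IsRegularAt x (α i)) :
    ∃ r : ℕ, ∀ i, ((r * A) • D).IsSection (t ^ r * α i) ∧
      (((r + 1) * A) • D).IsSection (t ^ (r + 1) * α i) := by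
  have key : ∀ i, ∃ L₀ : ℕ, ∀ L, L₀ ≤ L → ((L * A) • D).IsSection (t ^ L * α i) := by
    intro i
    have hβ : (0 • D).IsSectionOn ((A • D).nonvanishing t) (α i) := by
      intro c y _ hy
      rw [CartierDivisor.smul_f, pow_zero, one_mul]
      exact hα i y hy
    obtain ⟨L₀, hL₀⟩ := D.exists_forall_le_isSection_pow_mul ht hβ
    exact ⟨L₀, fun L hL => by simpa only [zero_add] using hL₀ L hL⟩
  choose L₀ hL₀ using key
  exact ⟨Finset.univ.sup L₀, fun i =>
    ⟨hL₀ i _ (Finset.le_sup (Finset.mem_univ i)),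
      hL₀ i _ ((Finset.le_sup (f := L₀) (Finset.mem_univ i)).trans (Nat.le_succ _))⟩⟩

end Extension

/-! ### §4 Dimension: `dim X = n` from étale coordinates on an affine open -/

section Dimension

variable {k : Type u} [Field k] {X : Scheme.{u}} [IsIntegral X] (f₀ : X ⟶ Spec (.of k))

/-- **`dim X = n`** when some nonempty affine open `W` carries étale coordinates
`k[x_1, …, x_n] → Γ(X, W)` (then `W → Spec k` is smooth of relative dimension `n`, so
`dim X = dim W = n`; Görtz–Wedhorn I, Thm. 5.22 (3) and Lemma 6.26). [folklore] -/
theorem topologicalKrullDim_eq_of_etale_coordinates [LocallyOfFiniteType f₀] {n : ℕ} {W : X.Opens}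
    (hW : IsAffineOpen W) (hηW : genericPoint X ∈ W)
    (algW : Algebra (MvPolynomial (Fin n) k) Γ(X, W))
    (hst : letI := sectionsAlgebra (pull f₀) W; IsScalarTower k (MvPolynomial (Fin n) k) Γ(X, W))
    (het : Algebra.Etale (MvPolynomial (Fin n) k) Γ(X, W)) :
    topologicalKrullDim X = n := by
  letI := sectionsAlgebra (pull f₀) W
  haveI := hst
  haveI := het
  have h1 : Algebra.IsStandardSmoothOfRelativeDimension n k Γ(X, W) :=
    isStandardSmoothOfRelativeDimension_of_etale_mvPolynomial
  have h2 : (sectionsHom (pull f₀) W).IsStandardSmoothOfRelativeDimension n :=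
    (RingHom.isStandardSmoothOfRelativeDimension_algebraMap n).mpr h1
  haveI := smoothOfRelativeDimension_ι_comp f₀ hW h2
  haveI : Nonempty W := ⟨⟨genericPoint X, hηW⟩⟩
  rw [← topologicalKrullDim_opens_eq f₀ W ⟨genericPoint X, hηW⟩]
  exact topologicalKrullDim_eq_of_smoothOfRelativeDimension (W.ι ≫ f₀) n

/-- … and then every proper closed subset has dimension `< n`. [folklore] -/
theorem topologicalKrullDim_lt_of_etale_coordinates [LocallyOfFiniteType f₀] {n : ℕ} {W : X.Opens}
    (hW : IsAffineOpen W) (hηW : genericPoint X ∈ W)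
    (algW : Algebra (MvPolynomial (Fin n) k) Γ(X, W))
    (hst : letI := sectionsAlgebra (pull f₀) W; IsScalarTower k (MvPolynomial (Fin n) k) Γ(X, W))
    (het : Algebra.Etale (MvPolynomial (Fin n) k) Γ(X, W)) {Z : Set X} (hZc : IsClosed Z)
    (hZ : Z ≠ Set.univ) : topologicalKrullDim Z < (n : ℕ) := by
  have hdim := topologicalKrullDim_eq_of_etale_coordinates f₀ hW hηW algW hst het
  refine topologicalKrullDim_lt_of_isClosed_ssubset hZc hZ n ?_
  rw [hdim]
  exact_mod_cast Nat.lt_succ_self n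

end Dimension

/-! ### §5 The family `Σ` and Kedlaya's polynomials `U₀, …, Uₙ` -/

section Family

/-- Bookkeeping: concatenating the families `(s'_l)_{l ≤ N₀}`, `t'`, `(b_j)_{j < n}` into one family
indexed by `Fin (N₀ + 1 + n + 1)`, remembering where each member went. [folklore] -/
theorem exists_fin_family {K : Type*} {N₀ n : ℕ} (s' : Fin (N₀ + 1) → K) (t' : K) (b : Fin n → K)
    (P : K → Prop) (hs' : ∀ l, P (s' l)) (ht' : P t') (hb : ∀ j, P (b j)) :
    ∃ (σ : Fin (N₀ + 1 + n + 1) → K) (ιs : Fin (N₀ + 1) → Fin (N₀ + 1 + n + 1))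
      (ιt : Fin (N₀ + 1 + n + 1)) (ιb : Fin n → Fin (N₀ + 1 + n + 1)),
      (∀ i, P (σ i)) ∧ (∀ l, σ (ιs l) = s' l) ∧ σ ιt = t' ∧ ∀ j, σ (ιb j) = b j := by
  let eqv : Fin (N₀ + 1) ⊕ (Fin 1 ⊕ Fin n) ≃ Fin (N₀ + 1 + n + 1) :=
    ((Equiv.sumCongr (Equiv.refl _) finSumFinEquiv).trans finSumFinEquiv).trans
      (finCongr (by omega))
  refine ⟨fun i => Sum.elim s' (Sum.elim (fun _ => t') b) (eqv.symm i), fun l => eqv (Sum.inl l),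
    eqv (Sum.inr (Sum.inl 0)), fun j => eqv (Sum.inr (Sum.inr j)), fun i => ?_, fun l => ?_, ?_,
    fun j => ?_⟩
  · change P (Sum.elim s' (Sum.elim (fun _ => t') b) (eqv.symm i))
    rcases eqv.symm i with l | z | j
    exacts [hs' l, ht', hb j]
  · simp only [Equiv.symm_apply_apply, Sum.elim_inl]
  · simp only [Equiv.symm_apply_apply, Sum.elim_inr, Sum.elim_inl]
  · simp only [Equiv.symm_apply_apply, Sum.elim_inr]

variable {k : Type u} [Field k] {M n : ℕ} (ιt : Fin (M + 1)) (ιb : Fin n → Fin (M + 1))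
  (T : Fin n → MvPolynomial (Fin (M + 1)) k) (m p : ℕ)

/-- **Kedlaya's polynomials are forms of degree `m + 1 = pδ`**: `Uₙ = Y_{t'}^{m+1}`,
`U_j = Y_{b_j} Y_{t'}^m + T_j^p` with `deg T_j = δ` (proof of Thm. 1: "`u₀ = t^{pl}`,
`uᵢ = sᵢ s^{m(pr-1)} t^{p(l-1)} + tᵢ^p`, each a section of `𝓛^{⊗lrmp}`").
[cite: Kedlaya2004, proof of Thm. 1] -/
theorem U_mem_grading {U : Fin (n + 1) → MvPolynomial (Fin (M + 1)) k}
    (hUlast : U (Fin.last n) = MvPolynomial.X ιt ^ (m + 1))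
    (hUcast : ∀ j, U (Fin.castSucc j) = MvPolynomial.X (ιb j) * MvPolynomial.X ιt ^ m + T j ^ p)
    {δ : ℕ} (hT : ∀ j, T j ∈ grading (Fin (M + 1)) k δ) (hm : m + 1 = δ * p) (j : Fin (n + 1)) :
    U j ∈ grading (Fin (M + 1)) k (m + 1) := by
  induction j using Fin.lastCases with
  | last =>
    rw [hUlast]
    change (MvPolynomial.X ιt ^ (m + 1) : MvPolynomial (Fin (M + 1)) k).IsHomogeneous (m + 1)
    simpa only [one_mul] using (MvPolynomial.isHomogeneous_X k ιt).pow (m + 1)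
  | cast j =>
    rw [hUcast]
    change (MvPolynomial.X (ιb j) * MvPolynomial.X ιt ^ m + T j ^ p).IsHomogeneous (m + 1)
    have h1 : (MvPolynomial.X (ιb j) * MvPolynomial.X ιt ^ m :
        MvPolynomial (Fin (M + 1)) k).IsHomogeneous (m + 1) := by
      have := (MvPolynomial.isHomogeneous_X k (ιb j)).mul
        ((MvPolynomial.isHomogeneous_X k ιt).pow m)
      rwa [show 1 + 1 * m = m + 1 by ring] at this
    have h2 : (T j ^ p).IsHomogeneous (m + 1) := by
      rw [hm]
      exact (hT j : (T j).IsHomogeneous δ).pow p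
    exact h1.add h2

variable {X : Scheme.{u}} [IsIntegral X] [X.Over (Spec (.of k))] {E : CartierDivisor X}
  {σ : Fin (M + 1) → X.functionField}
  (hsS : ∀ i, E.IsSection (σ i)) (hξS : ∀ i, genericPoint X ∈ E.nonvanishingOpens (σ i))
  (hcovS : ∀ x : X, ∃ i, x ∈ E.nonvanishing (σ i))

include hsS hξS hcovS in
/-- **The `u_j = U_j(Σ)` have no common zero** ("which do not vanish simultaneously at any point
of `Z`. Then the sections … have no common zero", proof of Thm. 1): on `X_{t'}` the last one is a
unit; off `X_{t'}` some `T_j(Σ)` is a unit and `Y_{b_j} Y_{t'}^m` vanishes (`m ≥ 1`), so `U_j(Σ)` is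
a unit — read through the homogeneous primes `ψ_Σ(x)` (`CartierDivisor.mem_nonvanishing_aeval_iff`).
[cite: Kedlaya2004, proof of Thm. 1] -/
theorem exists_mem_nonvanishing_U {U : Fin (n + 1) → MvPolynomial (Fin (M + 1)) k}
    (hUlast : U (Fin.last n) = MvPolynomial.X ιt ^ (m + 1))
    (hUcast : ∀ j, U (Fin.castSucc j) = MvPolynomial.X (ιb j) * MvPolynomial.X ιt ^ m + T j ^ p)
    {δ : ℕ} (hδ : 0 < δ) (hT : ∀ j, T j ∈ grading (Fin (M + 1)) k δ) (hm : m + 1 = δ * p)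
    (hm1 : 1 ≤ m)
    (hTcov : ∀ x, x ∉ E.nonvanishing (σ ιt) → ∃ j, x ∈ (δ • E).nonvanishing (aeval σ (T j)))
    (x : X) : ∃ j, x ∈ ((m + 1) • E).nonvanishing (aeval σ (U j)) := by
  have hUmem := U_mem_grading ιt ιb T m p hUlast hUcast hT hm
  set q := ((E.toGeneratingSections σ hsS hξS hcovS).toProj (X ↘ Spec (.of k))).base x with hq
  have hprime := q.isPrime
  have key : ∀ j, x ∈ ((m + 1) • E).nonvanishing (aeval σ (U j)) ↔ U j ∉ q.asHomogeneousIdeal :=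
    fun j => E.mem_nonvanishing_aeval_iff hsS hξS hcovS (Nat.succ_pos m) (hUmem j) x
  have keyt : x ∈ E.nonvanishing (σ ιt) ↔
      (MvPolynomial.X ιt : MvPolynomial (Fin (M + 1)) k) ∉ q.asHomogeneousIdeal := by
    have := E.mem_nonvanishing_aeval_iff hsS hξS hcovS one_pos (X_mem k ιt) x
    rwa [MvPolynomial.aeval_X, E.one_smul] at this
  by_cases hx : x ∈ E.nonvanishing (σ ιt)
  · refine ⟨Fin.last n, (key _).mpr ?_⟩
    rw [hUlast]
    exact fun h => keyt.mp hx (hprime.mem_of_pow_mem _ h)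
  · obtain ⟨j, hj⟩ := hTcov x hx
    have hTj : T j ∉ q.asHomogeneousIdeal :=
      (E.mem_nonvanishing_aeval_iff hsS hξS hcovS hδ (hT j) x).mp hj
    have hXt : (MvPolynomial.X ιt : MvPolynomial (Fin (M + 1)) k) ∈ q.asHomogeneousIdeal := by
      by_contra h
      exact hx (keyt.mpr h)
    refine ⟨Fin.castSucc j, (key _).mpr ?_⟩
    rw [hUcast]
    intro h
    have h1 : (MvPolynomial.X (ιb j) * MvPolynomial.X ιt ^ m : MvPolynomial (Fin (M + 1)) k) ∈
        q.asHomogeneousIdeal :=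
      Ideal.mul_mem_left _ _ (Ideal.pow_mem_of_mem _ hXt m hm1)
    have h2 : T j ^ p ∈ q.asHomogeneousIdeal := by
      have := Ideal.sub_mem _ h h1
      rwa [add_sub_cancel_left] at this
    exact hTj (hprime.mem_of_pow_mem _ h2)

end Family

/-! ### §6 The étale ring map of the last chart -/

section EtaleChart

variable {k : Type u} [Field k] {X : Scheme.{u}} [IsIntegral X] (f₀ : X ⟶ Spec (.of k)) {n : ℕ}

omit [IsIntegral X] in
/-- Étale coordinates on an open *equal* to a basic open of `V` (transport of
`exists_etale_coordinates_basicOpen` along an equality of opens). [folklore] -/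
theorem exists_etale_coordinates_of_eq_basicOpen {V : X.Opens} (hV : IsAffineOpen V)
    (alg : Algebra (MvPolynomial (Fin n) k) Γ(X, V))
    (hst : letI := sectionsAlgebra (pull f₀) V; IsScalarTower k (MvPolynomial (Fin n) k) Γ(X, V))
    (het : Algebra.Etale (MvPolynomial (Fin n) k) Γ(X, V)) (r : Γ(X, V))
    (W : X.Opens) (hWV : W ≤ V) (hW : W = X.basicOpen r) :
    letI := sectionsAlgebra (pull f₀) W
    ∃ _ : Algebra (MvPolynomial (Fin n) k) Γ(X, W),
      IsScalarTower k (MvPolynomial (Fin n) k) Γ(X, W) ∧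
      Algebra.Etale (MvPolynomial (Fin n) k) Γ(X, W) ∧
      ∀ i, algebraMap (MvPolynomial (Fin n) k) Γ(X, W) (MvPolynomial.X i) =
        X.presheaf.map (homOfLE hWV).op
          (algebraMap (MvPolynomial (Fin n) k) Γ(X, V) (MvPolynomial.X i)) := by
  subst hW
  exact exists_etale_coordinates_basicOpen f₀ hV alg hst het r

omit [Field k] in
/-- `ofSection` is additive (it is a ring homomorphism `Γ(X, U) → K(X)`). [folklore] -/
theorem ofSection_add {U : X.Opens} (hU : genericPoint X ∈ U) (σ τ : Γ(X, U)) :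
    ofSection hU (σ + τ) = ofSection hU σ + ofSection hU τ :=
  map_add _ _ _

omit [Field k] in
/-- `ofSection` is multiplicative on powers. [folklore] -/
theorem ofSection_pow {U : X.Opens} (hU : genericPoint X ∈ U) (σ : Γ(X, U)) (m : ℕ) :
    ofSection hU (σ ^ m) = ofSection hU σ ^ m :=
  map_pow _ _ _

variable (p : ℕ) [CharP k p]

/-- **The coordinates `aⱼ + γⱼᵖ` are nonzero**: `d(aⱼ + γⱼᵖ) = daⱼ` (`d(γᵖ) = p γ^{p-1} dγ = 0`
in characteristic `p`) is a basis vector of `Ω_{Γ(X,W)/k}` (proof of Thm. 1: "we can write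
`uᵢ/u₀ = aᵢ + cᵢᵖ` … `d(uᵢ/u₀) = … daᵢ`"). [cite: Kedlaya2004, proof of Thm. 1] -/
theorem coord_add_pow_ne_zero [LocallyOfFiniteType f₀] {W : X.Opens}
    (hηW : genericPoint X ∈ W) (algW : Algebra (MvPolynomial (Fin n) k) Γ(X, W))
    (hst : letI := sectionsAlgebra (pull f₀) W; IsScalarTower k (MvPolynomial (Fin n) k) Γ(X, W))
    (het : Algebra.Etale (MvPolynomial (Fin n) k) Γ(X, W)) (γ : Γ(X, W)) (j : Fin n) :
    algebraMap (MvPolynomial (Fin n) k) Γ(X, W) (MvPolynomial.X j) + γ ^ p ≠ 0 := by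
  letI := sectionsAlgebra (pull f₀) W
  haveI := hst
  haveI := het
  haveI : Nonempty W := ⟨⟨_, hηW⟩⟩
  haveI : CharP Γ(X, W) p :=
    charP_of_injective_algebraMap (algebraMap k Γ(X, W)).injective p
  obtain ⟨b, hb⟩ := exists_basis_kaehler_of_formallyEtale (k := k) (A := Γ(X, W)) (n := n)
  exact ne_zero_of_D_eq_basis b j (by rw [D_add_pow_char, ← hb])

/-- **The chart ring map `y_j ↦ aⱼ + γⱼᵖ` is étale** (proof of Thm. 1: "`d(u₁/u₀), …, d(uₙ/u₀)`
freely generate `Ω`", so `f` is unramified and "hence étale" by [SGA 1, Exposé II, Cor. 4.6]; here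
the Jacobi–Zariski criterion `ringHom_etale_of_basis`, `Γ(X, W)` being smooth over `k` as it is
étale over `k[x]`). [cite: Kedlaya2004, proof of Thm. 1] -/
theorem etale_eval₂Hom_of_coordinates [LocallyOfFiniteType f₀] {W : X.Opens}
    (hηW : genericPoint X ∈ W) (algW : Algebra (MvPolynomial (Fin n) k) Γ(X, W))
    (hst : letI := sectionsAlgebra (pull f₀) W; IsScalarTower k (MvPolynomial (Fin n) k) Γ(X, W))
    (het : Algebra.Etale (MvPolynomial (Fin n) k) Γ(X, W)) (ρ γ : Fin n → Γ(X, W))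
    (hρ : ∀ j, ρ j = algebraMap (MvPolynomial (Fin n) k) Γ(X, W) (MvPolynomial.X j) + γ j ^ p) :
    (MvPolynomial.eval₂Hom (sectionsHom (pull f₀) W) ρ).Etale := by
  letI := sectionsAlgebra (pull f₀) W
  haveI := hst
  haveI := het
  haveI : Algebra.Smooth k Γ(X, W) := smooth_of_etale_mvPolynomial (n := n)
  haveI : Nonempty W := ⟨⟨_, hηW⟩⟩
  haveI : CharP Γ(X, W) p :=
    charP_of_injective_algebraMap (algebraMap k Γ(X, W)).injective p
  obtain ⟨b, hb⟩ := exists_basis_kaehler_of_formallyEtale (k := k) (A := Γ(X, W)) (n := n)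
  exact ringHom_etale_of_basis (MvPolynomial.aeval ρ) b fun i => by
    rw [MvPolynomial.aeval_X, hρ, D_add_pow_char, hb]

/-- **`ψ` is étale over `D₊(yₙ)`** once `ψ⁻¹ D₊(yₙ) = X_{uₙ}` is a basic open of an affine `V`
carrying étale coordinates `a₁, …, aₙ` and the ratios `u_j/uₙ` have rational functions
`a_j + c_jᵖ` with `c_j` regular on `X_{uₙ}` (proof of Thm. 1, last paragraph).
[cite: Kedlaya2004, proof of Thm. 1] -/
theorem etale_toProj_chart [LocallyOfFiniteType f₀] (G : GeneratingSections (Fin (n + 1)) X)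
    {V : X.Opens} (hV : IsAffineOpen V) (hηV : genericPoint X ∈ V)
    (algV : Algebra (MvPolynomial (Fin n) k) Γ(X, V))
    (hstV : letI := sectionsAlgebra (pull f₀) V; IsScalarTower k (MvPolynomial (Fin n) k) Γ(X, V))
    (hetV : Algebra.Etale (MvPolynomial (Fin n) k) Γ(X, V)) (t₀ : Γ(X, V))
    (hWt₀ : G.U (Fin.last n) = X.basicOpen t₀) (hηW : genericPoint X ∈ G.U (Fin.last n))
    (c : Fin n → X.functionField) (hc : ∀ j, ∀ y ∈ G.U (Fin.last n), IsRegularAt y (c j))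
    (hratio : ∀ j, ofSection hηW (G.ratio (Fin.last n) (Fin.castSucc j)) =
      ofSection hηV (algebraMap (MvPolynomial (Fin n) k) Γ(X, V) (MvPolynomial.X j)) + c j ^ p) :
    Etale (G.toProj f₀ ∣_ ProjSpace.U (Fin.last n)) := by
  have hWV : G.U (Fin.last n) ≤ V := hWt₀.le.trans (X.basicOpen_le t₀)
  have hWaff : IsAffineOpen (G.U (Fin.last n)) := by rw [hWt₀]; exact hV.basicOpen t₀
  obtain ⟨algW, hstW, hetW, hcoordW⟩ :=
    exists_etale_coordinates_of_eq_basicOpen f₀ hV algV hstV hetV t₀ _ hWV hWt₀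
  set γ : Fin n → Γ(X, G.U (Fin.last n)) := fun j => sectionOf hηW (c j) (hc j) with hγ
  refine etale_morphismRestrict_toProj G f₀ hWaff
    (etale_eval₂Hom_of_coordinates f₀ p hηW algW hstW hetW _ γ fun j => ?_)
  have key : ofSection hηW (G.ratio (Fin.last n) (Fin.castSucc j)) =
      ofSection hηW (algebraMap (MvPolynomial (Fin n) k) Γ(X, G.U (Fin.last n))
        (MvPolynomial.X j) + γ j ^ p) := by
    rw [hratio j, ofSection_add, ofSection_pow, hcoordW j, ofSection_map, hγ, ofSection_sectionOf]
  exact germ_injective_of_isIntegral X (genericPoint X) hηW key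

end EtaleChart

/-! ### §7 Assembly: the finite morphism `ψ : X → ℙⁿ` étale over `D₊(yₙ)` -/

section Assembly

variable {k : Type u} [Field k] [PerfectField k] (p : ℕ) (hp : p.Prime) [CharP k p]
  {X : Scheme.{u}} [IsIntegral X] [X.Over (Spec (.of k))] [IsProper (X ↘ Spec (.of k))]

include hp in
/-- **Kedlaya 2004, Theorem 1, for generating sections with affine charts on an integral proper
`X` over a perfect field of characteristic `p`**: there are `n` and a finite surjective
`k`-morphism `ψ : X → ℙⁿ_k` étale over `D₊(yₙ)`. The proof follows Kedlaya's (see the module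
docstring for the dictionary). [cite: Kedlaya2004, Thm. 1 and its proof] -/
theorem exists_finite_etale_off_hyperplane {N : ℕ} (G : GeneratingSections (Fin (N + 1)) X)
    (hGaff : ∀ l, IsAffineOpen (G.U l)) :
    ∃ (n : ℕ) (ψ : X ⟶ ProjSpace.P n k), ψ ≫ toSpec (Fin (n + 1)) k = X ↘ Spec (.of k) ∧
      IsFinite ψ ∧ Function.Surjective ψ.base ∧ Etale (ψ ∣_ ProjSpace.U (Fin.last n)) := by
  classical
  set f₀ : X ⟶ Spec (.of k) := X ↘ Spec (.of k) with hf₀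
  haveI : CompactSpace X := compactSpace_of_isProper k X
  haveI : IsNoetherian X := isNoetherian_of_isProper k X
  -- §1 the base family
  obtain ⟨D, N₀, s, V₀, hs, hξ, hcov, haff, -, hηV₀, hchart⟩ := exists_base_family G hGaff
  -- étale coordinates `a₁, …, aₙ` on an affine `V ∋ η`, `V ⊆ V₀` (Lemma 6)
  obtain ⟨V, n, algV, hV, hηV, hVV₀, hstV, hetV⟩ := exists_etale_coordinates f₀ V₀ hηV₀
  letI := algV
  set a : Fin n → Γ(X, V) := fun i =>
    algebraMap (MvPolynomial (Fin n) k) Γ(X, V) (MvPolynomial.X i) with ha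
  -- §2 the form `t`
  obtain ⟨A, t, hA, ht, hηt, htaff, htV⟩ := exists_form_t (k := k) hs hξ hcov haff V hηV
  have htreg : ∀ y ∈ V, IsRegularAt y t := fun y hy => (hchart A t ht y (hVV₀ hy)).1
  set t₀ : Γ(X, V) := sectionOf hηV t htreg with ht₀
  have ht₀t : ofSection hηV t₀ = t := ofSection_sectionOf hηV t htreg
  have hXt : (A • D).nonvanishingOpens t = X.basicOpen t₀ := by
    ext y
    constructor
    · intro hy
      have hyV : y ∈ V := htV y hy
      have h1 : IsUnitAt y t := ((hchart A t ht y (hVV₀ hyV)).2).mp hy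
      rw [← ht₀t] at h1
      exact (isUnitAt_ofSection_iff hyV t₀).mp h1
    · intro hy
      have hyV : y ∈ V := X.basicOpen_le t₀ hy
      have h1 : IsUnitAt y (ofSection hηV t₀) := (isUnitAt_ofSection_iff hyV t₀).mpr hy
      rw [ht₀t] at h1
      exact ((hchart A t ht y (hVV₀ hyV)).2).mpr h1
  have ht0 : t ≠ 0 := CartierDivisor.ne_zero_of_mem_nonvanishing hηt
  -- the rational functions `αᵢ` of the coordinates, regular on `V ⊇ X_t`
  set α : Fin n → X.functionField := fun i => ofSection hηV (a i) with hα
  have hαreg : ∀ i, ∀ y ∈ (A • D).nonvanishing t, IsRegularAt y (α i) :=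
    fun i y hy => isRegularAt_ofSection (htV y hy) (a i)
  have hane : ∀ i, a i ≠ 0 := by
    intro i
    letI := sectionsAlgebra (pull f₀) V
    haveI := hstV
    haveI := hetV
    haveI : Nonempty V := ⟨⟨_, hηV⟩⟩
    obtain ⟨bV, hbV⟩ := exists_basis_kaehler_of_formallyEtale (k := k) (A := Γ(X, V)) (n := n)
    exact ne_zero_of_D_eq_basis bV i (hbV i).symm
  have hαne : ∀ i, α i ≠ 0 := fun i h =>
    hane i ((map_eq_zero_iff _ (germ_injective_of_isIntegral X (genericPoint X) hηV)).mp h)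
  -- §3 extension: `t^r αᵢ`, `bᵢ := t^{r+1} αᵢ` are sections; `e := A (r+1)`, `t' := t^{r+1}`
  obtain ⟨r, hr⟩ := exists_pow_mul_isSection ht α hαreg
  set e := A * (r + 1) with he
  have he0 : 0 < e := Nat.mul_pos hA (Nat.succ_pos r)
  have ht' : (e • D).IsSection (t ^ (r + 1)) := ht.pow D (r + 1)
  have ht'0 : t ^ (r + 1) ≠ 0 := pow_ne_zero _ ht0
  have hb : ∀ i, (e • D).IsSection (t ^ (r + 1) * α i) := fun i => by
    have := (hr i).2
    rwa [Nat.mul_comm] at this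
  have hbne : ∀ i, t ^ (r + 1) * α i ≠ 0 := fun i => mul_ne_zero ht'0 (hαne i)
  have hXt' : (e • D).nonvanishing (t ^ (r + 1)) = (A • D).nonvanishing t :=
    D.nonvanishing_smul_pow (Nat.succ_pos r) ht
  -- `X_{bᵢ} = X_{t₀ aᵢ}` is affine
  have hXb : ∀ i, (e • D).nonvanishingOpens (t ^ (r + 1) * α i) = X.basicOpen (t₀ * a i) := by
    intro i
    ext y
    change y ∈ (e • D).nonvanishing (t ^ (r + 1) * α i) ↔ y ∈ X.basicOpen (t₀ * a i)
    rw [Scheme.basicOpen_mul, Opens.mem_inf]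
    constructor
    · intro hy
      have hyt' : y ∈ (e • D).nonvanishing (t ^ (r + 1)) := by
        by_contra hyt
        obtain ⟨c, hyc, hu⟩ := hy
        have h1 : IsRegularAt y ((A • D).f c * t) := ht c y hyc
        have h1u : ¬ IsUnitAt y ((A • D).f c * t) := fun h =>
          hyt (by rw [hXt']; exact ⟨c, hyc, h⟩)
        have h2 : IsRegularAt y (((r * A) • D).f c * (t ^ r * α i)) := (hr i).1 c y hyc
        refine not_isUnitAt_mul h1 h1u h2 ?_
        have e1 : (A • D).f c * t * (((r * A) • D).f c * (t ^ r * α i)) =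
            (e • D).f c * (t ^ (r + 1) * α i) := by
          simp only [CartierDivisor.smul_f, he]
          ring
        rw [e1]
        exact hu
      have hyt : y ∈ (A • D).nonvanishing t := by rw [← hXt']; exact hyt'
      have hyV : y ∈ V := htV y hyt
      refine ⟨?_, ?_⟩
      · change y ∈ (X.basicOpen t₀ : X.Opens)
        rw [← hXt]
        exact hyt
      · rw [← isUnitAt_ofSection_iff hyV (a i)]
        have := (CartierDivisor.isUnitAt_div_iff_mem_nonvanishing (D := e • D)
          (t := t ^ (r + 1) * α i) hyt').mpr hy
        rwa [mul_div_cancel_left₀ _ ht'0] at this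
    · rintro ⟨hy1, hy2⟩
      have hyt : y ∈ (A • D).nonvanishing t := by
        change y ∈ (A • D).nonvanishingOpens t
        rw [hXt]
        exact hy1
      have hyV : y ∈ V := htV y hyt
      have hyt' : y ∈ (e • D).nonvanishing (t ^ (r + 1)) := by rw [hXt']; exact hyt
      have hu : IsUnitAt y (α i) := (isUnitAt_ofSection_iff hyV (a i)).mpr hy2
      refine (CartierDivisor.isUnitAt_div_iff_mem_nonvanishing (D := e • D)
        (t := t ^ (r + 1) * α i) hyt').mp ?_
      rwa [mul_div_cancel_left₀ _ ht'0]
  have haffb : ∀ i, IsAffineOpen ((e • D).nonvanishingOpens (t ^ (r + 1) * α i)) := fun i => by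
    rw [hXb i]
    exact hV.basicOpen _
  have hafft' : IsAffineOpen ((e • D).nonvanishingOpens (t ^ (r + 1))) := by
    have : (e • D).nonvanishingOpens (t ^ (r + 1)) = (A • D).nonvanishingOpens t := Opens.ext hXt'
    rw [this]
    exact htaff
  -- §4 the family `Σ = (s_l^e)_l, t', (bᵢ)ᵢ` of sections of `e • D`
  have hs1 : ∀ l, ((1 : ℕ) • D).IsSection (s l) := fun l => by rw [D.one_smul]; exact hs l
  have hsl : ∀ l, (e • D).IsSection (s l ^ e) := fun l => by
    simpa only [one_mul] using (hs1 l).pow D e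
  have hXsl : ∀ l, (e • D).nonvanishing (s l ^ e) = D.nonvanishing (s l) := fun l => by
    have := D.nonvanishing_smul_pow (d := 1) he0 (hs1 l)
    rwa [one_mul, D.one_smul] at this
  obtain ⟨σ, ιs, ιt, ιb, hσP, hσs, hσt, hσb⟩ := exists_fin_family (fun l => s l ^ e)
    (t ^ (r + 1)) (fun i => t ^ (r + 1) * α i)
    (fun τ => (e • D).IsSection τ ∧ genericPoint X ∈ (e • D).nonvanishingOpens τ ∧
      IsAffineOpen ((e • D).nonvanishingOpens τ))
    (fun l => ⟨hsl l, by
        change genericPoint X ∈ (e • D).nonvanishing (s l ^ e)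
        rw [hXsl]
        exact hξ l, by
        rw [show (e • D).nonvanishingOpens (s l ^ e) = D.nonvanishingOpens (s l) from
          Opens.ext (hXsl l)]
        exact haff l⟩)
    ⟨ht', (genericPoint_mem_nonvanishing_iff _ _).mpr ht'0, hafft'⟩
    (fun i => ⟨hb i, (genericPoint_mem_nonvanishing_iff _ _).mpr (hbne i), haffb i⟩)
  have hsS : ∀ i, (e • D).IsSection (σ i) := fun i => (hσP i).1
  have hξS : ∀ i, genericPoint X ∈ (e • D).nonvanishingOpens (σ i) := fun i => (hσP i).2.1
  have haffS : ∀ i, IsAffineOpen ((e • D).nonvanishingOpens (σ i)) := fun i => (hσP i).2.2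
  have hcovS : ∀ x : X, ∃ i, x ∈ (e • D).nonvanishing (σ i) := fun x => by
    obtain ⟨l, hl⟩ := hcov x
    exact ⟨ιs l, by rw [hσs, hXsl]; exact hl⟩
  -- étale coordinates on `W := X_t = X_{t₀}` and `dim (X ∖ W) < n = dim X`
  set W : X.Opens := (A • D).nonvanishingOpens t with hWdef
  have hWV : W ≤ V := fun y hy => htV y hy
  have hηW : genericPoint X ∈ W := hηt
  obtain ⟨algW, hstW, hetW, hcoordW⟩ :=
    exists_etale_coordinates_of_eq_basicOpen f₀ hV algV hstV hetV t₀ W hWV hXt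
  have hWne : ((W : Set X)ᶜ) ≠ Set.univ := fun h => by
    have : genericPoint X ∈ (W : Set X)ᶜ := by rw [h]; exact Set.mem_univ _
    exact this hηW
  have hdimZ : topologicalKrullDim ↥((W : Set X)ᶜ) < (n : ℕ) :=
    topologicalKrullDim_lt_of_etale_coordinates f₀ htaff hηW algW hstW hetW
      W.isOpen.isClosed_compl hWne
  -- the forms `T₁, …, Tₙ` of degree `δ = 2^c` with no common zero on `X ∖ X_t` (Lemma 5)
  obtain ⟨c, T, hT, -, hTZ⟩ := exists_forms_baseLocus_inter_eq_empty (K := k) hsS hξS hcovS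
    one_lt_two ((W : Set X)ᶜ) W.isOpen.isClosed_compl hdimZ
  set δ : ℕ := 2 ^ c with hδ
  have hδ0 : 0 < δ := Nat.two_pow_pos c
  have hTcov : ∀ x, x ∉ (e • D).nonvanishing (σ ιt) →
      ∃ j, x ∈ (δ • (e • D)).nonvanishing (aeval σ (T j)) := by
    intro x hx
    rw [hσt, hXt'] at hx
    by_contra hall
    have hmem : x ∈ (W : Set X)ᶜ ∩ CartierDivisor.baseLocus (K := k) σ (e • D) δ T :=
      ⟨hx, fun j hj => hall ⟨j, hj⟩⟩
    rw [hTZ] at hmem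
    exact hmem
  -- §5 Kedlaya's polynomials `U_j` (`m + 1 = δ p`)
  obtain ⟨m, hm⟩ : ∃ m, m + 1 = δ * p :=
    ⟨δ * p - 1, by have := Nat.mul_pos hδ0 hp.pos; omega⟩
  have hm1 : 1 ≤ m := by
    have h2 : 1 * 2 ≤ δ * p := Nat.mul_le_mul hδ0 hp.two_le
    omega
  set U : Fin (n + 1) → MvPolynomial (Fin (N₀ + 1 + n + 1)) k :=
    Fin.snoc (fun j => MvPolynomial.X (ιb j) * MvPolynomial.X ιt ^ m + T j ^ p)
      (MvPolynomial.X ιt ^ (m + 1)) with hUdef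
  have hUlast : U (Fin.last n) = MvPolynomial.X ιt ^ (m + 1) := Fin.snoc_last _ _
  have hUcast : ∀ j, U (Fin.castSucc j) =
      MvPolynomial.X (ιb j) * MvPolynomial.X ιt ^ m + T j ^ p := fun j => Fin.snoc_castSucc _ _ j
  have hUmem := U_mem_grading ιt ιb T m p hUlast hUcast hT hm
  set E' : CartierDivisor X := (m + 1) • (e • D) with hE'
  set u : Fin (n + 1) → X.functionField := fun j => aeval σ (U j) with hu
  have hu_s : ∀ j, E'.IsSection (u j) := fun j => (e • D).isSection_aeval hsS (hUmem j)
  have hcovU : ∀ x : X, ∃ j, x ∈ E'.nonvanishing (u j) :=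
    exists_mem_nonvanishing_U ιt ιb T m p hsS hξS hcovS hUlast hUcast hδ0 hT hm hm1 hTcov
  have haffU : ∀ j, IsAffineOpen (E'.nonvanishingOpens (u j)) := fun j =>
    (e • D).isAffineOpen_nonvanishingOpens_aeval hsS hξS hcovS haffS (Nat.succ_pos m) (hUmem j)
  -- the rational functions `c_j := T_j(Σ) / t'^δ`, regular on `W`, and `u_j = t'^{m+1}(α_j + c_jᵖ)`
  have hwreg : ∀ j, ∀ y ∈ W, IsRegularAt y (aeval σ (T j) / (t ^ (r + 1)) ^ δ) := by
    intro j y hy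
    have hw : ((e * δ) • D).IsSection (aeval σ (T j)) := by
      have := (e • D).isSection_aeval hsS (hT j)
      rwa [CartierDivisor.smul_smul] at this
    refine CartierDivisor.isRegularAt_div_of_mem_nonvanishing hw ?_
    rw [D.nonvanishing_smul_pow hδ0 ht', hXt']
    exact hy
  have hu_eq : ∀ j, u (Fin.castSucc j) =
      (t ^ (r + 1)) ^ (m + 1) * (α j + (aeval σ (T j) / (t ^ (r + 1)) ^ δ) ^ p) := by
    intro j
    have h1 : u (Fin.castSucc j) =
        t ^ (r + 1) * α j * (t ^ (r + 1)) ^ m + aeval σ (T j) ^ p := by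
      simp only [hu, hUcast, map_add, map_mul, map_pow, MvPolynomial.aeval_X, hσb, hσt]
    rw [h1, div_pow, ← pow_mul (t ^ (r + 1)) δ p, ← hm, mul_add, ← mul_div_assoc,
      mul_div_cancel_left₀ _ (pow_ne_zero _ ht'0)]
    ring
  have hul : u (Fin.last n) = (t ^ (r + 1)) ^ (m + 1) := by
    simp only [hu, hUlast, map_pow, MvPolynomial.aeval_X, hσt]
  have hφ : ∀ j, ofSection hηW (algebraMap (MvPolynomial (Fin n) k) Γ(X, W) (MvPolynomial.X j) +
      sectionOf hηW _ (hwreg j) ^ p) = α j + (aeval σ (T j) / (t ^ (r + 1)) ^ δ) ^ p := by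
    intro j
    rw [ofSection_add, ofSection_pow, hcoordW j, ofSection_map, ofSection_sectionOf]
  have hφne : ∀ j, algebraMap (MvPolynomial (Fin n) k) Γ(X, W) (MvPolynomial.X j) +
      sectionOf hηW _ (hwreg j) ^ p ≠ 0 := fun j =>
    coord_add_pow_ne_zero f₀ p hηW algW hstW hetW _ j
  have hune : ∀ j, u j ≠ 0 := by
    intro j
    induction j using Fin.lastCases with
    | last => rw [hul]; exact pow_ne_zero _ ht'0
    | cast j =>
      rw [hu_eq]
      refine mul_ne_zero (pow_ne_zero _ ht'0) ?_
      rw [← hφ]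
      exact (map_ne_zero_iff _ (germ_injective_of_isIntegral X (genericPoint X) hηW)).mpr (hφne j)
  have hξU : ∀ j, genericPoint X ∈ E'.nonvanishingOpens (u j) := fun j =>
    (genericPoint_mem_nonvanishing_iff _ _).mpr (hune j)
  -- the morphism `ψ := (u₀ : … : uₙ) : X → ℙⁿ`, affine hence finite
  set G' := E'.toGeneratingSections u hu_s hξU hcovU with hG'
  haveI : IsAffineHom (G'.toProj f₀) := GeneratingSections.isAffineHom_toProj _ _ haffU
  have hψk : G'.toProj f₀ ≫ toSpec (Fin (n + 1)) k = f₀ := GeneratingSections.toProj_toSpec _ _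
  haveI : IsFinite (G'.toProj f₀) := isFinite_of_isAffineHom_of_comp_eq _ hψk
  -- §6 the last chart `X_{uₙ} = X_t`
  have hWlast : G'.U (Fin.last n) = W := by
    ext y
    change y ∈ E'.nonvanishing (u (Fin.last n)) ↔ y ∈ (A • D).nonvanishing t
    rw [hul, hE', CartierDivisor.smul_smul, D.nonvanishing_smul_pow (Nat.succ_pos m) ht', hXt']
  have hWt₀ : G'.U (Fin.last n) = X.basicOpen t₀ := hWlast.trans hXt
  have hηW' : genericPoint X ∈ G'.U (Fin.last n) := hξU (Fin.last n)
  have hc : ∀ j, ∀ y ∈ G'.U (Fin.last n), IsRegularAt y (aeval σ (T j) / (t ^ (r + 1)) ^ δ) :=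
    fun j y hy => hwreg j y (by rw [hWlast] at hy; exact hy)
  have hratio : ∀ j, ofSection hηW' (G'.ratio (Fin.last n) (Fin.castSucc j)) =
      ofSection hηV (algebraMap (MvPolynomial (Fin n) k) Γ(X, V) (MvPolynomial.X j)) +
        (aeval σ (T j) / (t ^ (r + 1)) ^ δ) ^ p := by
    intro j
    have h1 := E'.germ_ratio u hu_s hξU (Fin.last n) (Fin.castSucc j) hηW'
    change ofSection hηW' (G'.ratio (Fin.last n) (Fin.castSucc j)) = _ at h1
    rw [h1, hu_eq, hul, mul_div_cancel_left₀ _ (pow_ne_zero _ ht'0)]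
  have het : Etale (G'.toProj f₀ ∣_ ProjSpace.U (Fin.last n)) :=
    etale_toProj_chart f₀ p G' hV hηV algV hstV hetV t₀ hWt₀ hηW' _ hc hratio
  -- surjectivity from finiteness and `dim X = n`
  have hdim : topologicalKrullDim X = n :=
    topologicalKrullDim_eq_of_etale_coordinates f₀ htaff hηW algW hstW hetW
  have hsurj : Surjective (G'.toProj f₀) := surjective_of_isFinite_of_dim _ hdim
  exact ⟨n, G'.toProj f₀, hψk, inferInstance, hsurj.1, het⟩

end Assembly

end Kedlaya2004

/-- **Kedlaya 2004, Theorem 1 (finite covers of `ℙⁿ` étale off one hyperplane) — discharge of the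
named fact `Kedlaya2004_finite_etale_off_hyperplane`**: for every prime `p`, perfect field `k` of
characteristic `p`, integral scheme `X` and finite `g : X → ℙᴺ_k`, there are `n` and a finite
surjective `k`-morphism `f : X → ℙⁿ_k` with `Etale (f ∣_ D₊(xₙ))`. Apply
`Kedlaya2004.exists_finite_etale_off_hyperplane` to the generating sections `g^* x_l` of `g`
(affine charts `g⁻¹ D₊(x_l)`), `X` being proper over `k` as `g` is finite and `ℙᴺ_k → Spec k` is
proper. [cite: Kedlaya2004, Thm. 1] -/
theorem Kedlaya2004_finite_etale_off_hyperplane_holds : Kedlaya2004_finite_etale_off_hyperplane := by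
  intro p hp k _ _ _ N X g _ hg
  -- read `g` as a morphism to `ProjSpace.P N k` (the same scheme, by `rfl`)
  let g' : X ⟶ ProjSpace.P N k := g
  haveI : IsFinite g' := hg
  letI : X.Over (Spec (.of k)) := ⟨g' ≫ toSpec (Fin (N + 1)) k⟩
  haveI : IsProper (toSpec (Fin (N + 1)) k) := ProjSpace.isProper_over N k
  haveI : IsProper (X ↘ Spec (.of k)) := by
    change IsProper (g' ≫ toSpec (Fin (N + 1)) k)
    infer_instance
  obtain ⟨n, ψ, hψk, hfin, hsurj, het⟩ :=
    Kedlaya2004.exists_finite_etale_off_hyperplane (k := k) p hp (GeneratingSections.ofHom g')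
      (GeneratingSections.isAffineOpen_ofHom_U g')
  exact ⟨n, ψ, hψk, hfin, hsurj, het⟩

end Literature.AlgebraicGeometry.Resolution

end
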